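import Summits.BirchSwinnertonDyer.BirchSwinnertonDyer.Theorems.GenusKolyvaginAtTwoK4NegBetaFrameDeepPrimeSupply
import HarnessLib

/-!
# Route `GenusKolyvaginAtTwo`, crux K₄⁻ `K4Neg` (stmt-BirchSwinnertonDyer-31526), the (β)-residual F4ᶠ —
# THE BLIND HALF OF THE SUPPLY: deep `FrobEqFrobInfty` Kolyvagin primes at which the level-`4` class is locally TRIVIAL

Width seat `bsd-line-gk2-p5` g43 (cell `bsd-f1-sign2`), WIDTH-5 attach on route `GenusKolyvaginAtTwo` rev 59, lane «the (β)-residual of K₄⁻».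
`--supports stmt-BirchSwinnertonDyer-31526 --as helper`.  THEOREMS ONLY (no definition, no named fact, no `sorry`); standard axioms.
**BSD is NOT proved by this file; `K4Neg` is NOT proved; no item is closed by it.**

Companion of `…BetaFrameDeepPrimeSupply` (gk2-p5 g43, p792420: deep primes with `h·h·Q − Q ≠ 0`).  Here the OTHER value of the one-bit law is
realised by primes: Čebotarev in the open set `c₀·(H ∩ Stab Q ∩ Stab(c₀Q))` gives deep `FrobEqFrobInfty` Kolyvagin primes `ℓ` (`ℓ ∤ N d_K`, `ℓ ≠ 2`,
inert in `K`, `4 ∣ ℓ+1`, `4 ∣ a_ℓ(W)`) with a Frobenius `h = c₀n`, `h = c₀` on `W[4]`, and **`h·h·Q − Q = 0`** (`c₀² = 1`, `n` fixes `Q` and `c₀Q`).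
No flip and no hypothesis on `Q` beyond `H` being open, conjugation-stable and fixing `W[4]` and `K` — so this half needs neither the entanglement
nor the «quarter moved» datum.  Together the two files say: among K4Neg's witness-type primes BOTH localisations of the level-`4` Kummer class of a
quarter of the entangled half occur (kernel form of the density-`½` dichotomy of the top bit; densities themselves are not claimed).

* `exists_deep_frobEqFrobInfty_prime_sq_smul_sub_eq_zero` — the blind half, abstract `H`.
* `exists_kolyvaginPrime_deep_sq_smul_sub_eq_zero` — in K4Neg's witness-prime currency (`Zhang2014.IsKolyvaginPrime`, `2 ≤ kolyvaginIndex`,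
  `FrobEqFrobInfty W K 4 ℓ`).

READING (census; nothing closed).  A two-prime mechanism for F4ᶠ (`n = ℓℓ′`) would take `ℓ` from this file (so that `c(ℓ)` is Selmer at `λ` and the
level-`(M₀+2)` base class is blind there) and `ℓ′` from the companion (so that `c(ℓ)`'s top bit is read at `λ′`).  BSD is NOT proved by any of this.

References: [McCallumLMS1991] §3 Prop. 3.1, Cor. 3.2; [GrossLMS1991] §3 (3.2)–(3.3), §9 Prop. 9.6; [MazurRubin2010] Lemma 3.5; [SilvermanAEC2009] VII.4.1, VIII.§2.
-/

set_option linter.dupNamespace false -- `Summit.<P>.<Sub>` repeats `BirchSwinnertonDyer` (D-0017)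
set_option autoImplicit false

noncomputable section

open scoped Classical Pointwise

namespace Summit.BirchSwinnertonDyer.BirchSwinnertonDyer.Theorems.GenusExact.Lw2PhantomExclusion.DeepPrimeOneBit

open WeierstrassCurve Field NumberField IsDedekindDomain
open Literature.NumberTheory.GaloisRepresentations Literature.NumberTheory.EllipticCurves
open Literature.NumberTheory
open Rat.HeightOneSpectrum
open Summit.BirchSwinnertonDyer.BirchSwinnertonDyer.Theorems.GenusKolyTwistingPrime

/-- ★★ **THE BLIND HALF OF THE SUPPLY.**  `W/ℚ` globally minimal, `V/ℚ` any Weierstrass curve carrying a point `Q ∈ V(ℚ̄)`, `K` imaginary quadratic,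
`N ≥ 1`, `c₀` a complex conjugation; `H ≤ Γ_ℚ` OPEN, conjugation-stable, fixing `W[4]` and `K` pointwise.  Then for every `b` there is a prime `ℓ > b`
with `ℓ ∤ N`, `ℓ ∤ d_K`, `ℓ ≠ 2`, `(ℓ)` prime in `𝓞 K`, `FrobEqFrobInfty W K 4 ℓ`, `4 ∣ ℓ + 1`, `4 ∣ a_ℓ(W)`, and an arithmetic Frobenius `h` at `ℓ`
acting on `W[4]` as `c₀` with **`h·h·Q − Q = 0`**.  (Čebotarev in `c₀·(H ∩ Stab Q ∩ Stab(c₀Q))`; `h = c₀n`, `h·h·Q = c₀·c₀·Q = Q`.)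
[cite: McCallumLMS1991, §3 Prop. 3.1, Cor. 3.2] [cite: GrossLMS1991, §3 (3.2)–(3.3)] [cite: MazurRubin2010, Lemma 3.5] -/
theorem exists_deep_frobEqFrobInfty_prime_sq_smul_sub_eq_zero
    (W : WeierstrassCurve ℚ) [W.IsElliptic] [W.IsGloballyMinimal] (V : WeierstrassCurve ℚ)
    {K : Type} [Field K] [NumberField K] (hK : IsImaginaryQuadratic K) (N : ℕ) [NeZero N]
    {c₀ : absoluteGaloisGroup ℚ} (hc₀ : IsComplexConjugation (Rat.castHom ℝ) c₀) (Q : geomPoints V)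
    {H : Subgroup (absoluteGaloisGroup ℚ)} (hHopen : IsOpen (H : Set (absoluteGaloisGroup ℚ)))
    (hHW : ∀ γ ∈ H, ∀ P : geomTorsion W ((2 ^ 2 : ℕ) : ℤ), γ • P = P)
    (hHK : ∀ γ ∈ H, ∀ x : K, γ • absEmbedding ℚ K x = absEmbedding ℚ K x) (b : ℕ) :
    ∃ ℓ : ℕ, b < ℓ ∧ ℓ.Prime ∧ ¬ ℓ ∣ N ∧ ¬ ((ℓ : ℤ) ∣ NumberField.discr K) ∧ ℓ ≠ 2 ∧
      (Ideal.span {(ℓ : 𝓞 K)}).IsPrime ∧ FrobEqFrobInfty W K (2 ^ 2) ℓ ∧ 2 ^ 2 ∣ ℓ + 1 ∧ ((2 : ℤ) ^ 2) ∣ W.frobeniusTrace ℓ ∧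
      ∃ (v : HeightOneSpectrum (𝓞 ℚ)) (𝔓 : Ideal (absIntegers (𝓞 ℚ) ℚ)) (h : absoluteGaloisGroup ℚ),
        (ℓ : 𝓞 ℚ) ∈ v.asIdeal ∧ 𝔓 ∈ v.primesAbove ∧ IsArithFrobAt (𝓞 ℚ) h 𝔓 ∧
        (∀ P : geomTorsion W ((2 ^ 2 : ℕ) : ℤ), h • P = c₀ • P) ∧ h • h • Q - Q = 0 := by
  classical
  have hp : Nat.Prime 2 := Nat.prime_two
  haveI : Fact (Nat.Prime 2) := ⟨hp⟩
  haveI : Algebra.IsQuadraticExtension ℚ K := ⟨hK.1⟩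
  haveI : IsTotallyComplex K := hK.2
  have hc1 : c₀ * c₀ = 1 := by rw [← sq]; exact hc₀.sq_eq_one
  -- ### the finite exceptional set of places of `ℚ`
  have hbad₀ : (W.badPlaces (𝓞 ℚ)).Finite := W.finite_badPlaces_holds (𝓞 ℚ)
  set B : Finset ℕ := {2} ∪ N.primeFactors ∪ (NumberField.discr K).natAbs.primeFactors ∪ Finset.range (b + 1) with hB
  set S₁ : Set (HeightOneSpectrum (𝓞 ℚ)) := {v | ∃ q ∈ B, q.Prime ∧ (q : 𝓞 ℚ) ∈ v.asIdeal} with hS₁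
  set S₂ : Set (HeightOneSpectrum (𝓞 ℚ)) := {v | ¬ Algebra.IsUnramifiedIn (𝓞 K) v.asIdeal} with hS₂
  have hS₁fin : S₁.Finite := by
    have : S₁ ⊆ ⋃ q ∈ (B.filter Nat.Prime), {v | (q : 𝓞 ℚ) ∈ v.asIdeal} := by
      intro v ⟨q, hqB, hq, hqv⟩
      simp only [Set.mem_iUnion, Finset.mem_filter]
      exact ⟨q, ⟨hqB, hq⟩, hqv⟩
    refine Set.Finite.subset (Set.Finite.biUnion (Finset.finite_toSet _) fun q hq ↦ ?_) this
    rw [Finset.coe_filter, Set.mem_setOf_eq] at hq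
    have hsub : {v : HeightOneSpectrum (𝓞 ℚ) | (q : 𝓞 ℚ) ∈ v.asIdeal}.Subsingleton :=
      fun v hv v' hv' ↦ HeightOneSpectrum.eq_of_natCast_mem_rat hq.2 hv hv'
    exact hsub.finite
  have hS₂fin : S₂.Finite := finite_setOf_not_isUnramifiedIn ℚ K
  set S := S₁ ∪ S₂ ∪ W.badPlaces (𝓞 ℚ) with hSdef
  have hSfin : S.Finite := (hS₁fin.union hS₂fin).union hbad₀
  -- ### Čebotarev in the open set `c₀ · (H ∩ Stab Q ∩ Stab (c₀·Q))`
  set A₁ : Subgroup (absoluteGaloisGroup ℚ) := MulAction.stabilizer (absoluteGaloisGroup ℚ) Q with hA₁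
  set A₂ : Subgroup (absoluteGaloisGroup ℚ) := MulAction.stabilizer (absoluteGaloisGroup ℚ) (c₀ • Q) with hA₂
  have hA₁open : IsOpen (A₁ : Set (absoluteGaloisGroup ℚ)) := V.isOpen_stabilizer_point_holds Q
  have hA₂open : IsOpen (A₂ : Set (absoluteGaloisGroup ℚ)) := V.isOpen_stabilizer_point_holds (c₀ • Q)
  set U : Set (absoluteGaloisGroup ℚ) := ((H : Set _) ∩ (A₁ : Set _)) ∩ (A₂ : Set _) with hU
  have hUopen : IsOpen U := (hHopen.inter hA₁open).inter hA₂open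
  set O : Set (absoluteGaloisGroup ℚ) := (fun n ↦ c₀ * n) '' U with hO
  have hOopen : IsOpen O := (Homeomorph.mulLeft c₀).isOpenMap _ hUopen
  have hOne : O.Nonempty := ⟨c₀ * 1, 1, ⟨⟨H.one_mem, A₁.one_mem⟩, A₂.one_mem⟩, rfl⟩
  obtain ⟨h, hhO, v, hvS, 𝔓₀, h𝔓₀, hh⟩ :=
    (absoluteGaloisGroup.frobenius_dense Automorphic.chebotarev_artinRep_holds ℚ S hSfin).inter_open_nonempty O hOopen hOne
  obtain ⟨n, ⟨⟨hnH, hnA₁⟩, hnA₂⟩, rfl⟩ := hhO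
  have hnQ : n • Q = Q := hnA₁
  have hnQ₁ : n • (c₀ • Q) = c₀ • Q := hnA₂
  have hhhQ : (c₀ * n) • (c₀ * n) • Q = Q := by
    rw [mul_smul, mul_smul, hnQ, hnQ₁, ← mul_smul, hc1, one_smul]
  have hrK : n ∈ (absGaloisRestrict ℚ K).range :=
    (mem_range_absGaloisRestrict_iff_smul_absEmbedding (F := ℚ) (M := K) n).mpr (hHK _ hnH)
  obtain ⟨g', hg'⟩ := hrK
  -- ### the rational prime `ℓ` under `v`
  obtain ⟨ℓ, hℓ, hℓv⟩ := exists_prime_natCast_mem v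
  have hℓB : ℓ ∉ B := fun hmem ↦ hvS (Or.inl (Or.inl ⟨ℓ, hmem, hℓ, hℓv⟩))
  simp only [hB, Finset.mem_union, Finset.mem_singleton, Nat.mem_primeFactors, Finset.mem_range, not_or] at hℓB
  obtain ⟨⟨⟨hℓp, hℓN⟩, hℓD⟩, hℓb⟩ := hℓB
  have hℓN' : ¬ ℓ ∣ N := fun hd ↦ hℓN ⟨hℓ, hd, NeZero.ne N⟩
  have hℓD' : ¬ ((ℓ : ℤ) ∣ NumberField.discr K) := fun hd ↦
    hℓD ⟨hℓ, Int.natAbs_dvd_natAbs.mpr hd |>.trans (by simp), by simp [NumberField.discr_ne_zero]⟩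
  have hbℓ : b < ℓ := by omega
  have hunr : Algebra.IsUnramifiedIn (𝓞 K) v.asIdeal := by
    by_contra hcon; exact hvS (Or.inl (Or.inr hcon))
  have hgood₀ : W.HasGoodReductionAt v := by
    by_contra hcon; exact hvS (Or.inr hcon)
  -- ### `ℓ` is inert in `K`
  have hHi := index_range_absGaloisRestrict_eq_finrank ℚ K
  haveI hRn : ((absGaloisRestrict ℚ K).range).Normal := Subgroup.normal_of_index_eq_two (hHi.trans hK.1)
  have hI := inertia_le_range_absGaloisRestrict_of_isUnramifiedIn (K := K) hunr h𝔓₀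
  have hΦH : c₀ * n ∉ (absGaloisRestrict ℚ K).range := by
    intro hmem
    apply hc₀.not_mem_range_absGaloisRestrict (L := K) IsTotallyComplex.isComplex
    change c₀ ∈ ((absGaloisRestrict ℚ K).range : Set (absoluteGaloisGroup ℚ))
    have h' : c₀ = c₀ * n * n⁻¹ := by group
    rw [SetLike.mem_coe, h']
    exact Subgroup.mul_mem _ hmem (Subgroup.inv_mem _ ⟨g', hg'⟩)
  obtain ⟨w, 𝔔, τ', hwv, hwuniq, -, h𝔔w, -, -, -⟩ :=
    exists_place_inert_of_not_mem_range (F := ℚ) (M := K) (hK.1 ▸ Nat.prime_two) hRn (hHi.trans rfl) hunr h𝔓₀ hI hh hΦH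
  have hwuniq' : ∀ w' : HeightOneSpectrum (𝓞 K), (ℓ : 𝓞 K) ∈ w'.asIdeal → w' = w := by
    intro w' hw'
    apply hwuniq
    apply HeightOneSpectrum.eq_of_natCast_mem_rat hℓ _ hℓv
    rw [HeightOneSpectrum.under_asIdeal, Ideal.under_def, Ideal.mem_comap, map_natCast]
    exact hw'
  have hspan : Ideal.span {(ℓ : 𝓞 K)} = w.asIdeal := by
    apply span_natCast_eq_of_unique hℓ w hwuniq'
    haveI : w.asIdeal.LiesOver v.asIdeal := ⟨by rw [← hwv]; rfl⟩
    have hmap : v.asIdeal.map (algebraMap (𝓞 ℚ) (𝓞 K)) = Ideal.span {(ℓ : 𝓞 K)} := by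
      rw [← span_natCast_rat_eq hℓ hℓv, Ideal.map_span, Set.image_singleton, map_natCast]
    have hne : v.asIdeal.map (algebraMap (𝓞 ℚ) (𝓞 K)) ≠ ⊥ := by
      rw [hmap, Ne, Ideal.span_singleton_eq_bot]; exact_mod_cast hℓ.ne_zero
    rw [← hmap, ← Ideal.IsDedekindDomain.ramificationIdx_eq_normalizedFactors_count v.asIdeal w.asIdeal hne]
    exact Ideal.ramificationIdx_eq_one_iff.mpr (hunr w.asIdeal w.isPrime inferInstance)
  -- ### `h` acts on `W[4]` and on `K` as `c₀`
  have hFE : ∀ P : geomTorsion W ((2 ^ 2 : ℕ) : ℤ), (c₀ * n) • P = c₀ • P := fun P ↦ by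
    rw [mul_smul, hHW _ hnH P]
  have h32 : FrobEqFrobInfty W K (2 ^ 2) ℓ := by
    refine ⟨v, 𝔓₀, c₀ * n, c₀, hℓv, h𝔓₀, hh, hc₀, fun P ↦ ?_, fun e x ↦ ?_⟩
    · exact_mod_cast hFE P
    · have hg'' : absGaloisRestrict ℚ K g' = n := hg'
      rw [mul_smul, ← hg'', absGaloisRestrict_smul_apply_eq g' e x]
  -- ### congruences and assembly
  have hℓ2 : ℓ ≠ 2 := hℓp
  have hM : 1 ≤ 2 := by norm_num
  have hdvd1 : 2 ^ 2 ∣ ℓ + 1 := pow_dvd_add_one_of_frobEqFrobInfty W (K := K) hp hM hℓ hℓ2 h32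
  have hdvd2 : ((2 : ℤ) ^ 2) ∣ W.frobeniusTrace ℓ := by
    have hd := pow_dvd_frobeniusTraceAt_of_frobEqFrobInfty W (K := K) hp hM hℓ hℓ2 h32 hℓv hgood₀
    rw [frobeniusTraceAt_eq_frobeniusTrace W v] at hd
    rwa [show ((primesEquiv v : ℕ)) = ℓ from primesEquiv_eq_of_natCast_mem hℓ hℓv] at hd
  refine ⟨ℓ, hbℓ, hℓ, hℓN', hℓD', hℓ2, hspan ▸ w.isPrime, h32, hdvd1, hdvd2, v, 𝔓₀, c₀ * n, hℓv, h𝔓₀, hh, hFE, ?_⟩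
  rw [hhhQ, sub_self]

/-- ★★ **THE BLIND HALF IN K4Neg's WITNESS-PRIME CURRENCY** (`N := W.conductorNorm ℤ`): beyond every bound a prime `ℓ` with
`Zhang2014.IsKolyvaginPrime (W.conductorNorm ℤ) W K 2 ℓ ∧ 2 ≤ kolyvaginIndex W 2 ℓ ∧ FrobEqFrobInfty W K 4 ℓ` and a Frobenius `h` at `ℓ`, `h = c₀` on
`W[4]`, with `h·h·Q − Q = 0`.  BSD / `K4Neg` NOT proved by this. [cite: WZhang2014, Notations (xii)] [cite: GrossLMS1991, §3 (3.2)–(3.3)] -/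
theorem exists_kolyvaginPrime_deep_sq_smul_sub_eq_zero
    (W : WeierstrassCurve ℚ) [W.IsElliptic] [W.IsGloballyMinimal] [NeZero (W.conductorNorm ℤ)] (V : WeierstrassCurve ℚ)
    {K : Type} [Field K] [NumberField K] (hK : IsImaginaryQuadratic K)
    {c₀ : absoluteGaloisGroup ℚ} (hc₀ : IsComplexConjugation (Rat.castHom ℝ) c₀) (Q : geomPoints V)
    {H : Subgroup (absoluteGaloisGroup ℚ)} (hHopen : IsOpen (H : Set (absoluteGaloisGroup ℚ)))
    (hHW : ∀ γ ∈ H, ∀ P : geomTorsion W ((2 ^ 2 : ℕ) : ℤ), γ • P = P)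
    (hHK : ∀ γ ∈ H, ∀ x : K, γ • absEmbedding ℚ K x = absEmbedding ℚ K x) (b : ℕ) :
    ∃ ℓ : ℕ, b < ℓ ∧ Zhang2014.IsKolyvaginPrime (W.conductorNorm ℤ) W K 2 ℓ ∧ 2 ≤ Zhang2014.kolyvaginIndex W 2 ℓ ∧
      FrobEqFrobInfty W K (2 ^ 2) ℓ ∧
      ∃ (v : HeightOneSpectrum (𝓞 ℚ)) (𝔓 : Ideal (absIntegers (𝓞 ℚ) ℚ)) (h : absoluteGaloisGroup ℚ),
        (ℓ : 𝓞 ℚ) ∈ v.asIdeal ∧ 𝔓 ∈ v.primesAbove ∧ IsArithFrobAt (𝓞 ℚ) h 𝔓 ∧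
        (∀ P : geomTorsion W ((2 ^ 2 : ℕ) : ℤ), h • P = c₀ • P) ∧ h • h • Q - Q = 0 := by
  haveI : Fact (Nat.Prime 2) := ⟨Nat.prime_two⟩
  obtain ⟨ℓ, hbℓ, hℓ, hℓN, hℓD, hℓ2, hprime, h32, hdvd1, hdvd2, hrest⟩ :=
    exists_deep_frobEqFrobInfty_prime_sq_smul_sub_eq_zero W V hK (W.conductorNorm ℤ) hc₀ Q hHopen hHW hHK b
  have hidx : 2 ≤ Zhang2014.kolyvaginIndex W 2 ℓ :=
    (Zhang2014.le_kolyvaginIndex_iff (W := W) (p := 2) (M := 2) (ℓ := ℓ)).mpr ⟨hdvd1, by exact_mod_cast hdvd2⟩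
  exact ⟨ℓ, hbℓ, ⟨hℓ, hℓN, hℓD, hℓ2, hprime, lt_of_lt_of_le (by norm_num) hidx⟩, hidx, h32, hrest⟩

end Summit.BirchSwinnertonDyer.BirchSwinnertonDyer.Theorems.GenusExact.Lw2PhantomExclusion.DeepPrimeOneBit

end
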